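import Mathlib
import Summits.Ventures.PercRepro.TriangleCapDeficiency

/-!
# PercRepro — ADDING INSIDE EDGES TO A GRAPH OF THE BAND: DEGREES, EDGE COUNT, TRIANGLE-FREENESS, OFF-DEGREES
(p3, gen 55; part 304)

`addEdges H S` is `H` with the (non-diagonal) pairs of the finset `S` added.  When no pair of `S` is an edge of `H`:
every degree grows by the number of added pairs at the vertex (`deg_addEdges`), the edge count by `|S|`
(`card_edgeFinset_addEdges`, by the handshake), and the off-degrees of a vertex `w` lying in no added pair grow the
same way (`offDeg_addEdges`, `deg_addEdges_of_notMem`).  The sum is triangle-free when `H` is, the added pairs form a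
triangle-free graph, no added pair has a common neighbour in `H`, and no two added pairs at a vertex are closed by an
edge of `H` (`cliqueFree_addEdges`).  This is the tool for the NON-bipartite witnesses of the band — the pair
witnesses of part 226 carry no inside edges, and the parity trick of part 301 needs them.  Axioms: standard.
-/

namespace PercRepro

namespace TriangleCap

namespace C047

open Finset

variable {V : Type*} [Fintype V] [DecidableEq V]

/-- `H` with the non-diagonal pairs of `S` added. -/
def addEdges (H : SimpleGraph V) (S : Finset (Sym2 V)) : SimpleGraph V where
  Adj u v := H.Adj u v ∨ (s(u, v) ∈ S ∧ u ≠ v)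
  symm := ⟨fun u v (h : H.Adj u v ∨ (s(u, v) ∈ S ∧ u ≠ v)) => by
    rcases h with h | ⟨h1, h2⟩
    · exact Or.inl (H.adj_symm h)
    · exact Or.inr ⟨by rw [Sym2.eq_swap]; exact h1, h2.symm⟩⟩
  loopless := ⟨fun u (h : H.Adj u u ∨ (s(u, u) ∈ S ∧ u ≠ u)) => by
    rcases h with h | ⟨-, h2⟩
    · exact H.irrefl h
    · exact h2 rfl⟩

/-- Adjacency in `addEdges` is decidable. -/
instance decidableRelAddEdges (H : SimpleGraph V) [DecidableRel H.Adj] (S : Finset (Sym2 V)) :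
    DecidableRel (addEdges H S).Adj :=
  fun u v => inferInstanceAs (Decidable (H.Adj u v ∨ (s(u, v) ∈ S ∧ u ≠ v)))

omit [Fintype V] [DecidableEq V] in
/-- Adjacency in `addEdges`. -/
theorem addEdges_adj (H : SimpleGraph V) (S : Finset (Sym2 V)) (u v : V) :
    (addEdges H S).Adj u v ↔ H.Adj u v ∨ (s(u, v) ∈ S ∧ u ≠ v) := Iff.rfl

/-- The added pairs at `v` correspond to the vertices `u` with `s(v, u) ∈ S`, `u ≠ v`. -/
theorem card_filter_mem_eq (S : Finset (Sym2 V)) (hS : ∀ e ∈ S, ¬ e.IsDiag) (v : V) :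
    (S.filter (fun e => v ∈ e)).card = (univ.filter (fun u => s(v, u) ∈ S ∧ v ≠ u)).card := by
  have hset : S.filter (fun e => v ∈ e) = (univ.filter (fun u => s(v, u) ∈ S ∧ v ≠ u)).image (fun u => s(v, u)) := by
    ext e
    simp only [mem_filter, mem_image, mem_univ, true_and]
    constructor
    · rintro ⟨heS, hve⟩
      induction e using Sym2.inductionOn with
      | hf x y =>
        have hnd := hS _ heS
        rw [Sym2.mem_iff] at hve
        rcases hve with rfl | rfl
        · refine ⟨y, ⟨heS, ?_⟩, rfl⟩
          intro h
          exact hnd (by rw [h]; exact Sym2.mk_isDiag_iff.mpr rfl)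
        · refine ⟨x, ⟨by rw [Sym2.eq_swap]; exact heS, ?_⟩, Sym2.eq_swap⟩
          intro h
          exact hnd (by rw [h]; exact Sym2.mk_isDiag_iff.mpr rfl)
    · rintro ⟨u, ⟨huS, -⟩, rfl⟩
      exact ⟨huS, Sym2.mem_mk_left v u⟩
  rw [hset, card_image_of_injOn]
  intro x _ y _ h
  simp only at h
  exact Sym2.congr_right.mp h

/-- **THE DEGREES OF `addEdges`:** when no pair of `S` is an edge of `H` and no pair is diagonal,
`d'(v) = d(v) + #{e ∈ S : v ∈ e}`. -/
theorem deg_addEdges (H : SimpleGraph V) [DecidableRel H.Adj] (S : Finset (Sym2 V))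
    (hS : ∀ e ∈ S, ¬ e.IsDiag) (hnew : ∀ u v, s(u, v) ∈ S → ¬ H.Adj u v) (v : V) :
    deg (addEdges H S) v = deg H v + (S.filter (fun e => v ∈ e)).card := by
  unfold deg
  rw [card_filter_mem_eq S hS v]
  have hsplit : univ.filter (fun u => (addEdges H S).Adj v u) =
      univ.filter (fun u => H.Adj v u) ∪ univ.filter (fun u => s(v, u) ∈ S ∧ v ≠ u) := by
    ext u
    simp only [mem_filter, mem_union, mem_univ, true_and, addEdges_adj]
  rw [hsplit, card_union_of_disjoint]
  rw [disjoint_left]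
  intro u hu hu'
  rw [mem_filter] at hu hu'
  exact hnew v u hu'.2.1 hu.2

/-- A non-diagonal pair has exactly two members. -/
theorem card_filter_mem_sym2 (e : Sym2 V) (he : ¬ e.IsDiag) : (univ.filter (fun v => v ∈ e)).card = 2 := by
  induction e using Sym2.inductionOn with
  | hf x y =>
    have hxy : x ≠ y := fun h => he (by rw [h]; exact Sym2.mk_isDiag_iff.mpr rfl)
    have : univ.filter (fun v => v ∈ s(x, y)) = {x, y} := by
      ext v
      simp only [mem_filter, mem_univ, true_and, Sym2.mem_iff, mem_insert, mem_singleton]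
    rw [this, card_pair hxy]

/-- The added pairs counted at their ends: `Σ_v #{e ∈ S : v ∈ e} = 2 |S|`. -/
theorem sum_card_filter_mem (S : Finset (Sym2 V)) (hS : ∀ e ∈ S, ¬ e.IsDiag) :
    ∑ v, (S.filter (fun e => v ∈ e)).card = 2 * S.card := by
  simp_rw [card_filter]
  rw [sum_comm, card_eq_sum_ones, mul_sum]
  apply sum_congr rfl
  intro e he
  have := card_filter_mem_sym2 e (hS e he)
  rw [card_filter] at this
  rw [this]
  norm_num

/-- **THE EDGE COUNT OF `addEdges`:** `|E(addEdges H S)| = |E(H)| + |S|` (the handshake). -/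
theorem card_edgeFinset_addEdges (H : SimpleGraph V) [DecidableRel H.Adj] (S : Finset (Sym2 V))
    (hS : ∀ e ∈ S, ¬ e.IsDiag) (hnew : ∀ u v, s(u, v) ∈ S → ¬ H.Adj u v) :
    (addEdges H S).edgeFinset.card = H.edgeFinset.card + S.card := by
  have h1 : ∑ v, deg (addEdges H S) v = 2 * (addEdges H S).edgeFinset.card := by
    simp_rw [deg_eq_degree]
    exact (addEdges H S).sum_degrees_eq_twice_card_edges
  have h2 : ∑ v, deg H v = 2 * H.edgeFinset.card := by
    simp_rw [deg_eq_degree]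
    exact H.sum_degrees_eq_twice_card_edges
  have h3 : ∑ v, deg (addEdges H S) v = ∑ v, deg H v + ∑ v, (S.filter (fun e => v ∈ e)).card := by
    rw [← sum_add_distrib]
    apply sum_congr rfl
    intro v _
    exact deg_addEdges H S hS hnew v
  rw [sum_card_filter_mem S hS] at h3
  omega

omit [Fintype V] [DecidableEq V] in
/-- `addEdges` does not change the adjacency of a vertex `w` lying in no added pair. -/
theorem addEdges_adj_of_notMem (H : SimpleGraph V) (S : Finset (Sym2 V)) (w : V) (hw : ∀ e ∈ S, w ∉ e) (v : V) :
    (addEdges H S).Adj w v ↔ H.Adj w v := by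
  rw [addEdges_adj]
  constructor
  · rintro (h | ⟨h, -⟩)
    · exact h
    · exact absurd (Sym2.mem_mk_left w v) (hw _ h)
  · exact Or.inl

/-- The degree of a vertex `w` lying in no added pair is unchanged. -/
theorem deg_addEdges_of_notMem (H : SimpleGraph V) [DecidableRel H.Adj] (S : Finset (Sym2 V)) (w : V)
    (hw : ∀ e ∈ S, w ∉ e) : deg (addEdges H S) w = deg H w := by
  unfold deg
  apply congrArg
  apply filter_congr
  intro v _
  exact addEdges_adj_of_notMem H S w hw v

/-- **THE OFF-DEGREES OF `addEdges`:** for `w` in no added pair, `offDeg' w v = offDeg w v + #{e ∈ S : v ∈ e}`. -/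
theorem offDeg_addEdges (H : SimpleGraph V) [DecidableRel H.Adj] (S : Finset (Sym2 V))
    (hS : ∀ e ∈ S, ¬ e.IsDiag) (hnew : ∀ u v, s(u, v) ∈ S → ¬ H.Adj u v) (w : V) (hw : ∀ e ∈ S, w ∉ e) (v : V) :
    offDeg (addEdges H S) w v = offDeg H w v + (S.filter (fun e => v ∈ e)).card := by
  by_cases hvw : v = w
  · subst hvw
    rw [offDeg_self, offDeg_self, card_eq_zero.mpr (filter_eq_empty_iff.mpr (fun e he hv => hw e he hv))]
  · have h1 := deg_eq_boole_add_offDeg (addEdges H S) w v hvw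
    have h2 := deg_eq_boole_add_offDeg H w v hvw
    have h3 := deg_addEdges H S hS hnew v
    have h4 : (if (addEdges H S).Adj w v then 1 else 0) = (if H.Adj w v then 1 else 0) := by
      by_cases h : H.Adj w v
      · rw [if_pos ((addEdges_adj_of_notMem H S w hw v).mpr h), if_pos h]
      · rw [if_neg (fun h' => h ((addEdges_adj_of_notMem H S w hw v).mp h')), if_neg h]
    omega

omit [Fintype V] [DecidableEq V] in
/-- `s(a, b) ∈ S ↔ s(b, a) ∈ S`. -/
theorem mem_swap_iff (S : Finset (Sym2 V)) (a b : V) : s(a, b) ∈ S ↔ s(b, a) ∈ S := by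
  rw [Sym2.eq_swap]

omit [Fintype V] in
/-- **THE TRIANGLE-FREENESS OF `addEdges`:** `H` triangle-free, the added pairs triangle-free, no added pair with a
common neighbour in `H`, no two added pairs at a vertex closed by an edge of `H`. -/
theorem cliqueFree_addEdges (H : SimpleGraph V) (S : Finset (Sym2 V)) (hfree : H.CliqueFree 3)
    (hS3 : ∀ a b c, s(a, b) ∈ S → s(b, c) ∈ S → s(a, c) ∈ S → False)
    (hcommon : ∀ a b c, s(a, b) ∈ S → H.Adj a c → H.Adj b c → False)
    (hmixed : ∀ a b c, s(a, b) ∈ S → s(b, c) ∈ S → H.Adj a c → False) :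
    (addEdges H S).CliqueFree 3 := by
  intro T hT
  obtain ⟨x, y, z, hxy, hxz, hyz, -⟩ := SimpleGraph.is3Clique_iff.mp hT
  rw [addEdges_adj] at hxy hxz hyz
  rcases hxy with hxy | ⟨hxy, -⟩ <;> rcases hxz with hxz | ⟨hxz, -⟩ <;> rcases hyz with hyz | ⟨hyz, -⟩
  · exact hfree {x, y, z} (SimpleGraph.is3Clique_triple_iff.mpr ⟨hxy, hxz, hyz⟩)
  · -- `s(y, z) ∈ S`, `H.Adj y x`, `H.Adj z x`
    exact hcommon y z x hyz (H.adj_symm hxy) (H.adj_symm hxz)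
  · -- `s(x, z) ∈ S`, `H.Adj x y`, `H.Adj z y`
    exact hcommon x z y hxz hxy (H.adj_symm hyz)
  · -- `s(x, z) ∈ S`, `s(y, z) ∈ S`, `H.Adj x y`
    exact hmixed x z y hxz ((mem_swap_iff S y z).mp hyz) hxy
  · -- `s(x, y) ∈ S`, `H.Adj x z`, `H.Adj y z`
    exact hcommon x y z hxy hxz hyz
  · -- `s(x, y) ∈ S`, `s(y, z) ∈ S`, `H.Adj x z`
    exact hmixed x y z hxy hyz hxz
  · -- `s(x, y) ∈ S`, `s(x, z) ∈ S`, `H.Adj y z`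
    exact hmixed y x z ((mem_swap_iff S x y).mp hxy) hxz hyz
  · exact hS3 x y z hxy hyz hxz

end C047

end TriangleCap

end PercRepro
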